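import Summits.BirchSwinnertonDyer.Rank1Residual.ManinAdditive.NeronFLineDepth
import Summits.BirchSwinnertonDyer.Rank1Residual.ManinAdditive.CharTwistTwoIsometry
import Summits.BirchSwinnertonDyer.Rank1Residual.O5.CharTwistPrimeIsometry
import Summits.BirchSwinnertonDyer.Rank1Residual.O5.CharTwistPrimeLevel
import HarnessLib

/-!
# The `f`-line index of ANY twist-stable `ℤ`-lattice is twist-invariant (conductors `p`, `4`, `8`; depleted `f`)

Summit `BirchSwinnertonDyer`, sub-problem `BirchSwinnertonDyer`, route `ManinLocalTwoThree`; width seat `bsd-line-manin23-p2`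
(gen 9), `--supports` the crux C2 `ManinOddAtFour` (stmt-BirchSwinnertonDyer-22967; the `p = 3` instance bears on C3
stmt-…-22968).  Cell `bsd-f2-manin`: the mechanism of desc g8's E-desc-54 (`S^T`, this seat's g8 file
`ManinLocalTwoThreeTranslationStableTwistInvariance`) abstracted from `B₃` to the tree's twists `R = charTwist` at every
conductor where the tree has the Petersson ISOMETRY on depleted forms — odd primes `p` (`O5.PrimeTwist`, cell `b2b-bsdres`),
`4` and `8` (`ManinAdditive.TwistAtTwo`, an g7) — so that the line index of EVERY `R`-stable `ℤ`-lattice (not only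
`S₂(Γ₀(N); ℤ)`, whose `f`-line index is the congruence number, TWIN in the tree) is invariant under `f ↦ f ⊗ χ`.
(desc E-desc-57's note «at `p = 2` the line index of the `⟨w_Q, t_{1/2}, A₄, B₄⟩`-stable lattice is `χ₋₄`-invariant,
40/40» becomes a theorem for any such lattice once typed: it is `B₄ = charTwist`-stable by definition.)

PROVED here (sorry-free):

* `lineIndex_eq_of_swap` — ABSTRACT SWAP LEMMA: an additive `R : S_k → S_k` preserving the `ℤ`-lattice `M`, with
  `R f = g`, `R g = f` and the isometries `⟨R f, R x⟩ = ⟨f, x⟩`, `⟨R g, R x⟩ = ⟨g, x⟩` (all `x`), induces mutually inverse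
  bijections `M ⧸ (ℤ f + M ∩ f^⊥) ⇄ M ⧸ (ℤ g + M ∩ g^⊥)`, so `lineIndex M f = lineIndex M g` (junk case `0 = 0` included);
* **`lineIndex_charTwist_prime`** — `p` prime, `p² ∣ N`, `χ` the quadratic primitive character mod `p`, `f` `p`-depleted,
  `M` twist-stable ⇒ `lineIndex M (f ⊗ χ) = lineIndex M f`;
* **`lineIndex_charTwist_four`** (`16 ∣ N`, `χ₋₄`, `f` `2`-depleted), **`lineIndex_charTwist_eight`** (`64 ∣ N`, `χ_{±8}`).

Elementary (Petersson adjointness of translates, Diamond–Shurman Prop. 5.5.2; Shimura 1971 Prop. 3.64).  BSD is not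
proved by this; Manin's conjecture is not proved by this.
-/

set_option autoImplicit false
set_option linter.dupNamespace false

noncomputable section

open scoped MatrixGroups ModularForm
open CongruenceSubgroup
open Literature.NumberTheory.EllipticCurves Literature.NumberTheory.EllipticCurves.ModularForms
open Summit.BirchSwinnertonDyer.Rank1Residual Summit.BirchSwinnertonDyer.Rank1Residual.ManinAdditive

namespace Summit.BirchSwinnertonDyer.BirchSwinnertonDyer.Theorems.ManinLocalTwoThree

variable {N : ℕ} [NeZero N]

/-! ### The abstract swap lemma -/

/-- **Abstract swap lemma for `f`-line indices.**  Let `R` be an additive, `ℤ`-homogeneous self-map of `S₂(Γ₀(N))`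
preserving a `ℤ`-lattice `M`, with `R f = g`, `R g = f`, and isometric against `f` and `g`: `⟨R f, R x⟩ = ⟨f, x⟩`,
`⟨R g, R x⟩ = ⟨g, x⟩` for all `x`.  Then `R` maps `ℤ f + M ∩ f^⊥` into `ℤ g + M ∩ g^⊥` and vice versa, and
`R² ≡ id` modulo `M ∩ f^⊥` on `M` (`⟨f, R²x⟩ = ⟨Rg, R(Rx)⟩ = ⟨g, Rx⟩ = ⟨Rf, Rx⟩ = ⟨f, x⟩`); so the two quotients are in
bijection and `lineIndex M f = lineIndex M g`. -/
theorem lineIndex_eq_of_swap {M : Submodule ℤ (CuspForm (Gamma0 N) 2)}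
    (R : CuspForm (Gamma0 N) 2 → CuspForm (Gamma0 N) 2) (hadd : ∀ x y, R (x + y) = R x + R y)
    (hzsmul : ∀ (z : ℤ) (x : CuspForm (Gamma0 N) 2), R (z • x) = z • R x) (hM : ∀ x ∈ M, R x ∈ M)
    {f g : CuspForm (Gamma0 N) 2} (hf : R f = g) (hg : R g = f)
    (hiso_f : ∀ x, peterssonProduct (Gamma0 N) 2 (R f) (R x) = peterssonProduct (Gamma0 N) 2 f x)
    (hiso_g : ∀ x, peterssonProduct (Gamma0 N) 2 (R g) (R x) = peterssonProduct (Gamma0 N) 2 g x) :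
    lineIndex M f = lineIndex M g := by
  -- the relative kernels `K h = ℤ h + M ∩ h^⊥` (inside `M`) and the restriction `RM` of `R` to `M`
  let K : CuspForm (Gamma0 N) 2 → Submodule ℤ M := fun h =>
    ((ℤ ∙ h) ⊔ (M ⊓ (LinearMap.ker (peterssonProductₗ (Gamma0 N) 2 h)).restrictScalars ℤ)).comap M.subtype
  have hsub : ∀ x y, R (x - y) = R x - R y := fun x y => by
    rw [sub_eq_add_neg, hadd, ← neg_one_zsmul, hzsmul, neg_one_zsmul, ← sub_eq_add_neg]
  let RM : M →ₗ[ℤ] M :=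
    { toFun := fun x => ⟨R x, hM x x.2⟩
      map_add' := fun x y => Subtype.ext (hadd x y)
      map_smul' := fun z x => Subtype.ext (hzsmul z x) }
  have hRM : ∀ x : M, ((RM x : M) : CuspForm (Gamma0 N) 2) = R x := fun x => rfl
  have hK : ∀ (h : CuspForm (Gamma0 N) 2) (x : M), x ∈ K h ↔
      (x : CuspForm (Gamma0 N) 2) ∈ (ℤ ∙ h) ⊔ (M ⊓ (LinearMap.ker (peterssonProductₗ (Gamma0 N) 2 h)).restrictScalars ℤ) :=
    fun h x => Submodule.mem_comap
  -- (1) `R` maps `K f'` into `K g'` whenever `R f' = g'` and `⟨R f', R ·⟩ = ⟨f', ·⟩`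
  have key : ∀ f' g' : CuspForm (Gamma0 N) 2, R f' = g' →
      (∀ x, peterssonProduct (Gamma0 N) 2 (R f') (R x) = peterssonProduct (Gamma0 N) 2 f' x) →
      K f' ≤ (K g').comap RM := by
    intro f' g' hf' hiso x hx
    rw [Submodule.mem_comap, hK, hRM]
    rw [hK] at hx
    obtain ⟨y, hy, z, hz, hyz⟩ := Submodule.mem_sup.mp hx
    obtain ⟨a, rfl⟩ := Submodule.mem_span_singleton.mp hy
    obtain ⟨hzM, hzk⟩ := Submodule.mem_inf.mp hz
    rw [← hyz, hadd, hzsmul, hf']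
    refine Submodule.mem_sup.mpr ⟨a • g', Submodule.mem_span_singleton.mpr ⟨a, rfl⟩, R z,
      Submodule.mem_inf.mpr ⟨hM z hzM, ?_⟩, rfl⟩
    rw [Submodule.restrictScalars_mem, LinearMap.mem_ker, peterssonProductₗ_apply] at hzk ⊢
    rw [← hf', hiso, hzk]
  -- (2) `R² x − x ∈ K f'` for `x ∈ M`
  have key2 : ∀ f' g' : CuspForm (Gamma0 N) 2, R f' = g' → R g' = f' →
      (∀ x, peterssonProduct (Gamma0 N) 2 (R f') (R x) = peterssonProduct (Gamma0 N) 2 f' x) →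
      (∀ x, peterssonProduct (Gamma0 N) 2 (R g') (R x) = peterssonProduct (Gamma0 N) 2 g' x) →
      ∀ x : M, RM (RM x) - x ∈ K f' := by
    intro f' g' hf' hg' hiso hiso' x
    rw [hK]
    refine Submodule.mem_sup_right (Submodule.mem_inf.mpr ⟨(RM (RM x) - x).2, ?_⟩)
    rw [Submodule.restrictScalars_mem, LinearMap.mem_ker, Submodule.coe_sub, hRM, hRM, map_sub,
      peterssonProductₗ_apply, peterssonProductₗ_apply]
    have h1 : peterssonProduct (Gamma0 N) 2 f' (R (R x)) = peterssonProduct (Gamma0 N) 2 f' x := by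
      rw [← hg', hiso', hg', ← hf', hiso]
    rw [h1, sub_self]
  -- (3) the mutually inverse induced maps
  change Nat.card (M ⧸ K f) = Nat.card (M ⧸ K g)
  refine Nat.card_congr
    { toFun := (K f).mapQ (K g) RM (key f g hf hiso_f)
      invFun := (K g).mapQ (K f) RM (key g f hg hiso_g)
      left_inv := fun q => ?_
      right_inv := fun q => ?_ }
  · induction q using Submodule.Quotient.induction_on with
    | H x => exact (Submodule.Quotient.eq _).mpr (key2 f g hf hg hiso_f hiso_g x)
  · induction q using Submodule.Quotient.induction_on with
    | H x => exact (Submodule.Quotient.eq _).mpr (key2 g f hg hf hiso_g hiso_f x)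

/-! ### Twists by the quadratic character of an odd prime conductor `p`, `p² ∣ N` -/

/-- **Line-index twist invariance, prime conductor.**  `p` prime, `p² ∣ N`, `χ` the primitive quadratic character mod
`p`, `f` `p`-depleted (e.g. a newform of level `N`), `M` a `ℤ`-lattice stable under `R = (· ⊗ χ)`: then
`lineIndex M (f ⊗ χ) = lineIndex M f` (isometry `O5.PrimeTwist.peterssonProduct_charTwist_charTwist`, involution
`O5.PrimeTwist.charTwist_charTwist`). -/
theorem lineIndex_charTwist_prime {p : ℕ} [Fact p.Prime] (hpN : p ^ 2 ∣ N) {χ : DirichletCharacter ℂ p}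
    (hχ : χ.IsQuadratic) (hprim : χ.IsPrimitive) {M : Submodule ℤ (CuspForm (Gamma0 N) 2)}
    (hM : ∀ x ∈ M, charTwist N dvd_rfl hpN hχ x ∈ M) {f : CuspForm (Gamma0 N) 2}
    (hf : ∀ n, p ∣ n → cuspCoeff f n = 0) :
    lineIndex M (charTwist N dvd_rfl hpN hχ f) = lineIndex M f := by
  have hg : ∀ n, p ∣ n → cuspCoeff (charTwist N dvd_rfl hpN hχ f) n = 0 := fun n hn =>
    O5.PrimeTwist.cuspCoeff_charTwist_eq_zero_of_dvd hpN hχ hprim f hn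
  exact (lineIndex_eq_of_swap (charTwist N dvd_rfl hpN hχ) (O5.PrimeTwist.charTwist_add hpN hχ hprim)
    (O5.PrimeTwist.charTwist_zsmul hpN hχ hprim) hM rfl (O5.PrimeTwist.charTwist_charTwist hpN hχ hprim hf)
    (O5.PrimeTwist.peterssonProduct_charTwist_charTwist hpN hχ hprim hf)
    (O5.PrimeTwist.peterssonProduct_charTwist_charTwist hpN hχ hprim hg)).symm

/-! ### Twists by `χ₋₄` (`16 ∣ N`) and `χ_{±8}` (`64 ∣ N`) -/

/-- **Line-index twist invariance, conductor 4.**  `16 ∣ N`, `χ = χ₋₄`, `f` `2`-depleted, `M` twist-stable ⇒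
`lineIndex M (f ⊗ χ₋₄) = lineIndex M f`. -/
theorem lineIndex_charTwist_four (h16 : 4 ^ 2 ∣ N) {χ : DirichletCharacter ℂ 4} (hχ : χ.IsQuadratic)
    (hprim : χ.IsPrimitive) {M : Submodule ℤ (CuspForm (Gamma0 N) 2)}
    (hM : ∀ x ∈ M, charTwist N dvd_rfl h16 hχ x ∈ M) {f : CuspForm (Gamma0 N) 2}
    (hf : ∀ n, 2 ∣ n → cuspCoeff f n = 0) :
    lineIndex M (charTwist N dvd_rfl h16 hχ f) = lineIndex M f := by
  have hu := TwistAtTwo.isUnit_natCast_zmod_four_iff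
  have hg : ∀ n, 2 ∣ n → cuspCoeff (charTwist N dvd_rfl h16 hχ f) n = 0 := fun n hn =>
    TwistAtTwo.cuspCoeff_charTwist_eq_zero_of_two_dvd h16 hχ hu hprim f hn
  exact (lineIndex_eq_of_swap (charTwist N dvd_rfl h16 hχ) (TwistAtTwo.charTwist_add h16 hχ hprim)
    (TwistAtTwo.charTwist_zsmul h16 hχ hprim) hM rfl (TwistAtTwo.charTwist_charTwist h16 hχ hu hprim hf)
    (TwistAtTwo.peterssonProduct_charTwist_charTwist_four h16 hχ hprim hf)
    (TwistAtTwo.peterssonProduct_charTwist_charTwist_four h16 hχ hprim hg)).symm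

/-- **Line-index twist invariance, conductor 8.**  `64 ∣ N`, `χ` primitive quadratic mod `8` (`χ(5) = −1`), `f`
`2`-depleted, `M` twist-stable ⇒ `lineIndex M (f ⊗ χ) = lineIndex M f`. -/
theorem lineIndex_charTwist_eight (h64 : 8 ^ 2 ∣ N) {χ : DirichletCharacter ℂ 8} (hχ : χ.IsQuadratic)
    (hprim : χ.IsPrimitive) (h5 : χ 5 = -1) {M : Submodule ℤ (CuspForm (Gamma0 N) 2)}
    (hM : ∀ x ∈ M, charTwist N dvd_rfl h64 hχ x ∈ M) {f : CuspForm (Gamma0 N) 2}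
    (hf : ∀ n, 2 ∣ n → cuspCoeff f n = 0) :
    lineIndex M (charTwist N dvd_rfl h64 hχ f) = lineIndex M f := by
  have hu := TwistAtTwo.isUnit_natCast_zmod_eight_iff
  have hg : ∀ n, 2 ∣ n → cuspCoeff (charTwist N dvd_rfl h64 hχ f) n = 0 := fun n hn =>
    TwistAtTwo.cuspCoeff_charTwist_eq_zero_of_two_dvd h64 hχ hu hprim f hn
  exact (lineIndex_eq_of_swap (charTwist N dvd_rfl h64 hχ) (TwistAtTwo.charTwist_add h64 hχ hprim)
    (TwistAtTwo.charTwist_zsmul h64 hχ hprim) hM rfl (TwistAtTwo.charTwist_charTwist h64 hχ hu hprim hf)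
    (TwistAtTwo.peterssonProduct_charTwist_charTwist_eight h64 hχ hprim h5 hf)
    (TwistAtTwo.peterssonProduct_charTwist_charTwist_eight h64 hχ hprim h5 hg)).symm

end Summit.BirchSwinnertonDyer.BirchSwinnertonDyer.Theorems.ManinLocalTwoThree

end
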